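import Summits.QuantumAdvantage.QuantumAdvantage.Theorems.CubicForrelationSignedCubicForrelationNotPrBPPStubQuarterIdentity
import Summits.QuantumAdvantage.QuantumAdvantage.Theorems.CubicForrelationSignedCubicForrelationNotPrBPPStubPeriodicIdentity
import Summits.QuantumAdvantage.QuantumAdvantage.Theorems.CubicForrelationSignedCubicForrelationNotPrBPPStubCoupledInvariance
import Summits.QuantumAdvantage.QuantumAdvantage.Theorems.CubicForrelationSignedCubicForrelationNotPrBPPStubKernelNormalForm

/-!
# Crux `CubicForrelation.SignedCubicForrelationNotPrBPP` (stmt-QuantumAdvantage-13931) — line `Sketch`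

The KERNEL-DESCENT STEP, composed from the landed stubs of the line: `stub_kernelNormalForm` (K3),
`stub_coupledInvariance` (K4), `stub_periodicIdentity` (K1') and `stub_quarterIdentity` (K1).

`descent_step` (registered sub-goal): a cubic pair `(a, b)` on `n + 2` bits whose second function has
an affine derivative in a direction `h ≠ 0` has its SIGNED forrelation expressed EXACTLY either as
`Φ(a,b) = Φ(a′(c,·), B)/√2` for a cubic pair on `n + 1` bits (periodic direction), or as the plain
average `Φ(a,b) = ¼ Σ_{q₀,q₁} Φ(a′_q ⊕ q₀q₁ ⊕ q₁c₀, B₀ ⊕ q₀B₁)` of four pairs on `n` bits built from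
cubic `a′`, cubic `B₀` and quadratic `B₁`; `descent_quarter_pairs_cubic` / `descent_periodic_pair_cubic`
record that the new pairs are again cubic (so the reduction stays inside the cubic signed problem),
and `descent_le_max_quarter` / `descent_min_quarter_le` the elementary monotonicity (an average of
the four quarter values lies between their min and max — for crux r2: kernel extensions cannot create
near-exact values exceeding every quarter).

This is the engine of card `kernel-descent` (crux ideas of stmt-QuantumAdvantage-13931) in both
directions: `X ⇒ TerminalHard` up to threshold bookkeeping (with `stub_maxQuarterRule` and the landed
`Φ²` estimator), and the self-reduction of the `¬X` programme of crux r7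
(`SignedCubicForrelationInPrBPP`) onto kernel-free pairs.
-/

noncomputable section

set_option linter.dupNamespace false -- D-0017: single-problem summit ⇒ QuantumAdvantage.QuantumAdvantage by design

namespace Summit.QuantumAdvantage.QuantumAdvantage.Theorems.SignedCubicForrelationNotPrBPP

open Finset Literature.Computability.QuantumComplexity
open Literature.Computability.QuantumComplexity.BuzetChailloux (bxor zeroVec)

/-- **Registered sub-goal `descent_step` (the kernel-descent reduction of line `Sketch`).** -/
theorem descent_step :
    ∀ (n : ℕ) (a b : (Fin (n + 2) → Bool) → Bool) (h : Fin (n + 2) → Bool), h ≠ zeroVec →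
      IsDegLeFun 3 a → IsDegLeFun 3 b → IsDegLeFun 1 (fun x => b x ^^ b (bxor x h)) →
      (∃ (a' : (Fin (n + 2) → Bool) → Bool) (c : Bool) (B : (Fin (n + 1) → Bool) → Bool),
          IsDegLeFun 3 a' ∧ IsDegLeFun 3 B ∧
          forrelation a b = (Real.sqrt 2)⁻¹ * forrelation (fun u => a' (Fin.cons c u)) B) ∨
      (∃ (a' : (Fin (n + 2) → Bool) → Bool) (c₀ : Bool) (B₀ B₁ : (Fin n → Bool) → Bool),
          IsDegLeFun 3 a' ∧ IsDegLeFun 3 B₀ ∧ IsDegLeFun 2 B₁ ∧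
          forrelation a b = (1 / 4 : ℝ) * ∑ q₀ : Bool, ∑ q₁ : Bool,
            forrelation (fun u => (a' (Fin.cons q₀ (Fin.cons q₁ u)) ^^ (q₀ && q₁)) ^^ (q₁ && c₀))
              (fun u => B₀ u ^^ (q₀ && B₁ u))) := by
  intro n a b h hh ha hb hder
  obtain ⟨e, e', hadj, hdeg, hform⟩ := stub_kernelNormalForm n b h hh hb hder
  have hinv := stub_coupledInvariance (n + 2) a b e e' hadj
  rcases hform with ⟨c, B, hB, hbe⟩ | ⟨c₀, B₀, B₁, hB₀, hB₁, hbe⟩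
  · refine Or.inl ⟨fun x => a (e' x), c, B, hdeg 3 a ha, hB, ?_⟩
    rw [← hinv, show (fun y => b (e y)) = fun x => (x 0 && c) ^^ B (Fin.tail x) from funext hbe]
    exact stub_periodicIdentity (n + 1) _ B c
  · refine Or.inr ⟨fun x => a (e' x), c₀, B₀, B₁, hdeg 3 a ha, hB₀, hB₁, ?_⟩
    rw [← hinv, show (fun y => b (e y)) =
      fun x => ((x 1 ^^ c₀) && (x 0 ^^ B₁ (Fin.tail (Fin.tail x)))) ^^ B₀ (Fin.tail (Fin.tail x))
      from funext hbe]
    exact stub_quarterIdentity n _ B₀ B₁ c₀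

/-- The four quarter pairs produced by `descent_step` are again CUBIC pairs (on `n` bits). -/
theorem descent_quarter_pairs_cubic {n : ℕ} {a' : (Fin (n + 2) → Bool) → Bool}
    {B₀ B₁ : (Fin n → Bool) → Bool} (ha' : IsDegLeFun 3 a') (hB₀ : IsDegLeFun 3 B₀)
    (hB₁ : IsDegLeFun 2 B₁) (c₀ q₀ q₁ : Bool) :
    IsDegLeFun 3 (fun u : Fin n → Bool => (a' (Fin.cons q₀ (Fin.cons q₁ u)) ^^ (q₀ && q₁)) ^^ (q₁ && c₀)) ∧
      IsDegLeFun 3 (fun u : Fin n → Bool => B₀ u ^^ (q₀ && B₁ u)) := by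
  constructor
  · have h1 : IsDegLeFun 3 (fun u : Fin n → Bool => a' (Fin.cons q₀ (Fin.cons q₁ u))) :=
      knf_isDegLeFun_comp ha' _ (knf_isDegLeFun_cons_cons_coord q₀ q₁)
    exact knf_isDegLeFun_xor_const (knf_isDegLeFun_xor_const h1 _) _
  · simpa using knf_isDegLeFun_xor' hB₀ (knf_isDegLeFun_const_and (hB₁.mono (by norm_num : 2 ≤ 3)) q₀)

/-- The periodic pair produced by `descent_step` is again a CUBIC pair (on `n + 1` bits). -/
theorem descent_periodic_pair_cubic {n : ℕ} {a' : (Fin (n + 2) → Bool) → Bool} (ha' : IsDegLeFun 3 a')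
    (c : Bool) : IsDegLeFun 3 (fun u : Fin (n + 1) → Bool => a' (Fin.cons c u)) :=
  knf_isDegLeFun_comp ha' _ (knf_isDegLeFun_cons_coord c)

/-- **Monotonicity of the descent (for r2 / isolation).** An average of four quarter values is at most
the largest of them: no quarter split can create a value exceeding every quarter. -/
theorem descent_le_max_quarter (Φ : Bool → Bool → ℝ) :
    ∃ q₀ q₁ : Bool, (1 / 4 : ℝ) * ∑ p₀ : Bool, ∑ p₁ : Bool, Φ p₀ p₁ ≤ Φ q₀ q₁ := by
  by_contra hcon
  simp only [not_exists, not_le] at hcon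
  have h1 := hcon true true
  have h2 := hcon true false
  have h3 := hcon false true
  have h4 := hcon false false
  simp only [Fintype.sum_bool] at h1 h2 h3 h4
  linarith

/-- … and at least the smallest of them. -/
theorem descent_min_quarter_le (Φ : Bool → Bool → ℝ) :
    ∃ q₀ q₁ : Bool, Φ q₀ q₁ ≤ (1 / 4 : ℝ) * ∑ p₀ : Bool, ∑ p₁ : Bool, Φ p₀ p₁ := by
  by_contra hcon
  simp only [not_exists, not_le] at hcon
  have h1 := hcon true true
  have h2 := hcon true false
  have h3 := hcon false true
  have h4 := hcon false false
  simp only [Fintype.sum_bool] at h1 h2 h3 h4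
  linarith

end Summit.QuantumAdvantage.QuantumAdvantage.Theorems.SignedCubicForrelationNotPrBPP

end
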